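import Summits.AtomisticToContinuum.Crystallization.Theorems.FreeSplittingCertificatesStrictSplittingRuleSummableTransfer

/-!
# `StrictSplittingRule` (stmt-AtomisticToContinuum-12560): the PAYMENT IDENTITY of a diagonal far table — its antisymmetrised transfer term is "receipts minus own payments" (P1 interpolant object, part 39)

Route `FreeSplittingCertificates`, crux r3 `StrictSplittingRule` (H12⋆ = `stub_coreJointCoercive`), unit b2b-freesplit-B gen 31.
VALUE = the bookkeeping identity behind the matched split's far half (HOME CERT §26 (2), §31 (d); FAR-LEMMA-SPEC §17): the far part of H12⋆'s
second-order table is DIAGONAL, `M b e s s' = [s = s']·(−t·R b e s)` (with `R = p1RecTable a h (p1SplitDensity R₁ R₂)`, part 35, and `N = 0`), and for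
such a table the transfer series of `CoreJointSiteIneq` at the site `p`,
`Σ'_{q ≠ p} Σ_{s,s'∈Y} [M(b_p)(q−p) s s'·g_p(s)g_p(s') − M(b_q)(p−q) s s'·g_q(s)g_q(s') + (N… − N…)·g_p(s)g_q(s')]`, `g_q(s) = ⟪y_{q+s} − y_q, u_{q+s} − u_q⟫`,
EQUALS `−t·PAY_p + t·REC_p` with `PAY_p = Σ'_{q≠p} Σ_s R(b_p)(q−p) s·g_p(s)²` (P's own payments into the other ledgers — a P-local demand the near
certificate carries) and `REC_p = Σ'_{q≠p} Σ_s R(b_q)(p−q) s·g_q(s)²` (the receipts that `farReceipts_le_tsum_table` spends), all three series summable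
(payments by the `(1+r)⁻⁶` decay of the table, receipts because `u` is finitely supported).  Stated for generic `M, N, R` tied by hypotheses, so the
assembly instantiates it by `rfl`.  NOT a proof of H12⋆, NOT summit progress.  [folklore]
-/

noncomputable section

namespace Summit.AtomisticToContinuum.Crystallization.Theorems.StrictSplittingRuleBirth

open scoped BigOperators Classical
open Literature.MathematicalPhysics.StatisticalMechanics
open Literature.Geometry.DiscreteGeometry
open Summit.AtomisticToContinuum.Crystallization.Theorems.PalmUnimodularRigidity.LayeredLawsSelectHcp
  (hcpSite ljSqDeriv)

/-- **PAYMENT IDENTITY (diagonal far table).**  For a table `M b e s s' = [s = s']·(−t·R b e s)`, `N = 0`, with `R` decaying like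
`(1+‖y_q − y_p‖)⁻⁶` in H12⋆'s convention, a finitely supported field `u` and a site `p`: the payments family and the receipts family are summable,
the antisymmetrised transfer family of `CoreJointSiteIneq` is summable, and its sum is `−t·(payments) + t·(receipts)`.
NOT a proof of H12⋆, NOT summit progress. -/
theorem farTable_transfer_eq_receipts_sub_payments {a h t C : ℝ} (ha : 0 < a) (hh : 0 < h) (Y : Finset (ℤ × ℤ × ℤ))
    (R : Bool → (ℤ × ℤ × ℤ) → (ℤ × ℤ × ℤ) → ℝ)
    (M N : Bool → (ℤ × ℤ × ℤ) → (ℤ × ℤ × ℤ) → (ℤ × ℤ × ℤ) → ℝ)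
    (hM : ∀ b e s s', M b e s s' = if s = s' then -(t * R b e s) else 0) (hN : ∀ b e s s', N b e s s' = 0)
    (hR : ∀ p q : ℤ × ℤ × ℤ, ∀ s, |R (decide (Even p.1)) (q - p) s| ≤ C * ((1 + ‖hcpSite a h q - hcpSite a h p‖)⁻¹) ^ 6)
    (u : ℤ × ℤ × ℤ → EuclideanSpace ℝ (Fin 3)) (hu : (Function.support u).Finite) (p : ℤ × ℤ × ℤ) :
    Summable (fun q : ℤ × ℤ × ℤ => if q = p then (0 : ℝ) else
      ∑ s ∈ Y, R (decide (Even p.1)) (q - p) s * (inner ℝ (hcpSite a h (p + s) - hcpSite a h p) (u (p + s) - u p)) ^ 2) ∧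
    Summable (fun q : ℤ × ℤ × ℤ => if q = p then (0 : ℝ) else
      ∑ s ∈ Y, R (decide (Even q.1)) (p - q) s * (inner ℝ (hcpSite a h (q + s) - hcpSite a h q) (u (q + s) - u q)) ^ 2) ∧
    Summable (fun q : ℤ × ℤ × ℤ => if q = p then (0 : ℝ) else
        ∑ s ∈ Y, ∑ s' ∈ Y,
          (M (decide (Even p.1)) (q - p) s s' *
              (inner ℝ (hcpSite a h (p + s) - hcpSite a h p) (u (p + s) - u p) *
                inner ℝ (hcpSite a h (p + s') - hcpSite a h p) (u (p + s') - u p)) -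
            M (decide (Even q.1)) (p - q) s s' *
              (inner ℝ (hcpSite a h (q + s) - hcpSite a h q) (u (q + s) - u q) *
                inner ℝ (hcpSite a h (q + s') - hcpSite a h q) (u (q + s') - u q)) +
            (N (decide (Even p.1)) (q - p) s s' - N (decide (Even q.1)) (p - q) s' s) *
              (inner ℝ (hcpSite a h (p + s) - hcpSite a h p) (u (p + s) - u p) *
                inner ℝ (hcpSite a h (q + s') - hcpSite a h q) (u (q + s') - u q)))) ∧
    (∑' q : ℤ × ℤ × ℤ, (if q = p then (0 : ℝ) else
        ∑ s ∈ Y, ∑ s' ∈ Y,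
          (M (decide (Even p.1)) (q - p) s s' *
              (inner ℝ (hcpSite a h (p + s) - hcpSite a h p) (u (p + s) - u p) *
                inner ℝ (hcpSite a h (p + s') - hcpSite a h p) (u (p + s') - u p)) -
            M (decide (Even q.1)) (p - q) s s' *
              (inner ℝ (hcpSite a h (q + s) - hcpSite a h q) (u (q + s) - u q) *
                inner ℝ (hcpSite a h (q + s') - hcpSite a h q) (u (q + s') - u q)) +
            (N (decide (Even p.1)) (q - p) s s' - N (decide (Even q.1)) (p - q) s' s) *
              (inner ℝ (hcpSite a h (p + s) - hcpSite a h p) (u (p + s) - u p) *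
                inner ℝ (hcpSite a h (q + s') - hcpSite a h q) (u (q + s') - u q))))) =
      -t * (∑' q : ℤ × ℤ × ℤ, if q = p then (0 : ℝ) else
        ∑ s ∈ Y, R (decide (Even p.1)) (q - p) s * (inner ℝ (hcpSite a h (p + s) - hcpSite a h p) (u (p + s) - u p)) ^ 2) +
      t * (∑' q : ℤ × ℤ × ℤ, if q = p then (0 : ℝ) else
        ∑ s ∈ Y, R (decide (Even q.1)) (p - q) s * (inner ℝ (hcpSite a h (q + s) - hcpSite a h q) (u (q + s) - u q)) ^ 2) := by
  -- abbreviations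
  set g : (ℤ × ℤ × ℤ) → (ℤ × ℤ × ℤ) → ℝ := fun q s => inner ℝ (hcpSite a h (q + s) - hcpSite a h q) (u (q + s) - u q) with hg
  set PAY : (ℤ × ℤ × ℤ) → ℝ := fun q => if q = p then (0 : ℝ) else ∑ s ∈ Y, R (decide (Even p.1)) (q - p) s * g p s ^ 2 with hPAY
  set REC : (ℤ × ℤ × ℤ) → ℝ := fun q => if q = p then (0 : ℝ) else ∑ s ∈ Y, R (decide (Even q.1)) (p - q) s * g q s ^ 2 with hREC
  -- (1) payments summable: decay of the table, g p s independent of q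
  have hPAYs : Summable PAY := by
    refine summableTransfer_guard p (summableTransfer_summable_of_abs_le ha hh p
      (C := C * ∑ s ∈ Y, g p s ^ 2) (F := fun q => ∑ s ∈ Y, R (decide (Even p.1)) (q - p) s * g p s ^ 2) fun q => ?_)
    calc |∑ s ∈ Y, R (decide (Even p.1)) (q - p) s * g p s ^ 2|
        ≤ ∑ s ∈ Y, |R (decide (Even p.1)) (q - p) s * g p s ^ 2| := Finset.abs_sum_le_sum_abs _ _
      _ ≤ ∑ s ∈ Y, C * ((1 + ‖hcpSite a h q - hcpSite a h p‖)⁻¹) ^ 6 * g p s ^ 2 := by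
          refine Finset.sum_le_sum fun s _ => ?_
          rw [abs_mul, abs_of_nonneg (sq_nonneg (g p s))]
          exact mul_le_mul_of_nonneg_right (hR p q s) (sq_nonneg _)
      _ = C * (∑ s ∈ Y, g p s ^ 2) * ((1 + ‖hcpSite a h q - hcpSite a h p‖)⁻¹) ^ 6 := by
          rw [Finset.mul_sum, Finset.sum_mul]; refine Finset.sum_congr rfl fun s _ => ?_; ring
  -- (2) receipts summable: the summand vanishes unless u q ≠ 0 or u (q+s) ≠ 0 for some s ∈ Y (finitely many q)
  have hRECs : Summable REC := by
    refine summableTransfer_guard p (summable_sum fun s _ => ?_)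
    refine summableTransfer_summable_of_vanish hu s fun q h1 h2 => ?_
    simp only [hg, h1, h2, sub_self, inner_zero_right]
    ring
  -- (3) termwise identity: the diagonal collapses the double stencil sum
  have hterm : ∀ q : ℤ × ℤ × ℤ, (if q = p then (0 : ℝ) else
        ∑ s ∈ Y, ∑ s' ∈ Y,
          (M (decide (Even p.1)) (q - p) s s' * (g p s * g p s') -
            M (decide (Even q.1)) (p - q) s s' * (g q s * g q s') +
            (N (decide (Even p.1)) (q - p) s s' - N (decide (Even q.1)) (p - q) s' s) * (g p s * g q s'))) =
      -t * PAY q + t * REC q := by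
    intro q
    simp only [hPAY, hREC]
    split_ifs with hq
    · ring
    · rw [Finset.mul_sum, Finset.mul_sum, ← Finset.sum_add_distrib]
      refine Finset.sum_congr rfl fun s hs => ?_
      simp only [hM, hN, sub_self, zero_mul, add_zero, ite_mul, Finset.sum_sub_distrib, Finset.sum_ite_eq, hs,
        if_true]
      ring
  have hfam : (fun q : ℤ × ℤ × ℤ => if q = p then (0 : ℝ) else
        ∑ s ∈ Y, ∑ s' ∈ Y,
          (M (decide (Even p.1)) (q - p) s s' * (g p s * g p s') -
            M (decide (Even q.1)) (p - q) s s' * (g q s * g q s') +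
            (N (decide (Even p.1)) (q - p) s s' - N (decide (Even q.1)) (p - q) s' s) * (g p s * g q s'))) =
      fun q => -t * PAY q + t * REC q := funext hterm
  refine ⟨hPAYs, hRECs, ?_, ?_⟩
  · rw [hfam]; exact (hPAYs.mul_left (-t)).add (hRECs.mul_left t)
  · rw [hfam, (hPAYs.mul_left (-t)).tsum_add (hRECs.mul_left t), tsum_mul_left, tsum_mul_left]

end Summit.AtomisticToContinuum.Crystallization.Theorems.StrictSplittingRuleBirth

end
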